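import Literature.Analysis.FluidPDE.KatoFixedPointMildBesov
import Literature.Analysis.FluidPDE.ClassicalSolutionCalculus
import Literature.Analysis.UnboundedOperators.HeatFlowCalculus
import Literature.Analysis.FunctionSpaces.GaussianSchwartz
import HarnessLib

/-!
# Pairing a `Ḃ^{-1}_{∞,∞}`-bounded field with a test field: the heat-flow duality bound

Analysis/FluidPDE proof file (theorems only; no definitions, no named facts) on the way to the
corrected form of Seregin–Zhou 2020, Thm 1.2 (`SereginZhou2020.lean`; G. Seregin, D. Zhou,
J. Math. Sci. 244 (2020) = arXiv:1802.03600). The new analytic ingredient of that theorem is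
the control of a field `f` by its heat-flow Besov quantity
`‖f‖_{Ḃ^{-1}_{∞,∞}} = sup_{s>0} √s ‖e^{sΔ}f‖_∞` (Seregin–Zhou 2020, p. 2), used through the
cut-off Lemma 2.2 (`‖φ f‖_{Ḃ^{-1}_{∞,∞}} ≤ c ‖f‖_{Ḃ^{-1}_{∞,∞}}`, proved in their Appendix by a
Duhamel formula). This file proves the elementary **duality substitute** for Lemma 2.2 that the
tree's proof uses instead:

* `norm_integral_inner_le_of_heatExtension_bound` — if `f` is measurable, integrable against
  centred Gaussians, and `‖e^{sΔ}f(y)‖ ≤ M s^{-1/2}` for all `s > 0`, `y`, then for every test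
  field `Φ ∈ C²_c(E; E)` and every `t > 0`,
  `|∫ ⟪f, Φ⟫| ≤ M (t^{-1/2} ∫‖Φ‖ + 2 t^{1/2} ∫‖ΔΦ‖)`.

Proof (heat-flow duality): for `0 < a < t`,
`∫⟪e^{tΔ}f, Φ⟫ − ∫⟪e^{aΔ}f, Φ⟫ = ∫ₐᵗ ∫⟪Δ e^{σΔ}f, Φ⟫ dσ = ∫ₐᵗ ∫⟪e^{σΔ}f, ΔΦ⟫ dσ`
(`integral_inner_heatExtension_sub_eq`: the heat equation for the bounded datum `e^{(a/2)Δ}f`,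
the semigroup law on Gaussian-integrable data
`Literature.Analysis.UnboundedOperators.heatExtension_heatExtension_of_integrable_heatKernel_mul_norm`,
Fubini on `[a, t] × supp Φ` and Green's identity `integral_inner_laplacian_comm`), whence
`|∫⟪e^{aΔ}f, Φ⟫| ≤ M t^{-1/2}‖Φ‖₁ + ∫ₐᵗ M σ^{-1/2}‖ΔΦ‖₁ dσ ≤ M (t^{-1/2}‖Φ‖₁ + 2√t ‖ΔΦ‖₁)`;
finally `∫⟪e^{aΔ}f, Φ⟫ = ∫⟪f, e^{aΔ}Φ⟫ → ∫⟪f, Φ⟫` as `a → 0⁺`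
(`integral_inner_heatExtension_comm_of_integrable_heatKernel` and
`tendsto_integral_inner_heatExtension_nhdsGT_zero`: Lipschitz modulus near `supp Φ`, Gaussian
tail away from it).

## References

* G. Seregin, D. Zhou, *Regularity of solutions to the Navier–Stokes equations in
  `Ḃ^{-1}_{∞,∞}`*, J. Math. Sci. 244 (2020) 1003–1009 = arXiv:1802.03600, §1 (the heat-flow
  norm, p. 2), Lemma 2.2 and Appendix §3. [`SereginZhou2020`]
* M. Ledoux, *On improved Sobolev embedding theorems*, Math. Res. Lett. 10 (2003), §1
  (heat-flow/duality proof of Besov-refined inequalities). [`Ledoux2003`]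
-/

noncomputable section

open MeasureTheory Set Function Filter Topology Metric InnerProductSpace
open scoped ENNReal NNReal RealInnerProductSpace Laplacian ContDiff

namespace Literature.Analysis.FluidPDE

open Literature.Analysis.UnboundedOperators

namespace HeatBesovPairing

variable {E : Type*} [NormedAddCommGroup E] [InnerProductSpace ℝ E] [FiniteDimensional ℝ E]
  [MeasurableSpace E] [BorelSpace E]

/-! ### Gaussian-integrable data: measurability and boundedness of the heat flow -/

variable {f : E → E} {M : ℝ}

/-- The caloric extension of a measurable field integrable against centred Gaussians is
a.e. strongly measurable (it is locally integrable). [folklore] -/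
theorem aestronglyMeasurable_heatExtension (hf : AEStronglyMeasurable f volume)
    (hG : ∀ a : ℝ, 0 < a → Integrable (fun y => heatKernel a y * ‖f y‖) volume)
    {s : ℝ} (hs : 0 < s) : AEStronglyMeasurable (heatExtension f s) volume :=
  (locallyIntegrable_heatExtension hf hG hs).aestronglyMeasurable

/-- Under the heat-flow bound `‖e^{sΔ}f‖ ≤ M s^{-1/2}`, each `e^{sΔ}f`, `s > 0`, is in `L^∞`.
[folklore] -/
theorem memLp_top_heatExtension (hf : AEStronglyMeasurable f volume)
    (hG : ∀ a : ℝ, 0 < a → Integrable (fun y => heatKernel a y * ‖f y‖) volume)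
    (hM : ∀ s : ℝ, 0 < s → ∀ y, ‖heatExtension f s y‖ ≤ M * s ^ (-(1 / 2 : ℝ)))
    {s : ℝ} (hs : 0 < s) : MemLp (heatExtension f s) ∞ volume :=
  memLp_top_of_bound (aestronglyMeasurable_heatExtension hf hG hs) _
    (Eventually.of_forall (hM s hs))

/-- Data integrable against centred Gaussians are integrable on bounded sets. [folklore] -/
theorem integrableOn_of_integrable_heatKernel_mul_norm (hf : AEStronglyMeasurable f volume)
    (hG : ∀ a : ℝ, 0 < a → Integrable (fun y => heatKernel a y * ‖f y‖) volume) {R : ℝ} :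
    IntegrableOn f (closedBall (0 : E) R) volume := by
  -- on the ball, `heatKernel 1 y ≥ m > 0`
  set m : ℝ := (4 * Real.pi * 1) ^ (-(Module.finrank ℝ E : ℝ) / 2) * Real.exp (-(1 / (4 * 1)) * R ^ 2)
    with hm
  have hm0 : 0 < m := by rw [hm]; positivity
  have hlow : ∀ y ∈ closedBall (0 : E) R, m ≤ heatKernel 1 y := by
    intro y hy
    rw [mem_closedBall, dist_zero_right] at hy
    rw [hm, heatKernel_eq]
    refine mul_le_mul_of_nonneg_left (Real.exp_le_exp.2 ?_) (by positivity)
    have : ‖y‖ ^ 2 ≤ R ^ 2 := by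
      by_cases hR : 0 ≤ R
      · exact pow_le_pow_left₀ (norm_nonneg _) hy 2
      · exact absurd (hy.trans (le_of_lt (not_le.1 hR))) (not_le.2 (by
          have := norm_nonneg y; linarith [not_le.1 hR]) )
    nlinarith
  have hint : IntegrableOn (fun y => m⁻¹ * (heatKernel 1 y * ‖f y‖)) (closedBall (0 : E) R) volume :=
    ((hG 1 one_pos).const_mul m⁻¹).integrableOn
  refine Integrable.mono' hint (hf.restrict) ?_
  filter_upwards [ae_restrict_mem measurableSet_closedBall] with y hy
  have h1 := hlow y hy
  calc ‖f y‖ = m⁻¹ * (m * ‖f y‖) := by field_simp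
    _ ≤ m⁻¹ * (heatKernel 1 y * ‖f y‖) := by gcongr

/-! ### The variation of the regularised pairing `σ ↦ ∫⟪e^{σΔ}h, Φ⟫` -/

section Variation

variable {Φ : E → E}

/-- Pairings of a continuous field with a continuous compactly supported one are integrable.
[folklore] -/
theorem integrable_inner_right (v : E → E) (hv : Continuous v) (hΦ : Continuous Φ)
    (hΦc : HasCompactSupport Φ) : Integrable (fun x => ⟪v x, Φ x⟫) (volume : Measure E) :=
  integrable_inner_of_hasCompactSupport_right hv hΦ hΦc

/-- **Fubini on `[a, b] × supp`** for an integrand continuous on `(0, ∞) × E` and vanishing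
off a compact set in the space variable. [folklore] -/
theorem integral_integral_swap_Ioc_of_continuousOn {G : ℝ → E → ℝ}
    (hcont : ContinuousOn (fun q : ℝ × E => G q.1 q.2) (Ioi 0 ×ˢ univ)) {K : Set E}
    (hK : IsCompact K) (hzero : ∀ σ x, x ∉ K → G σ x = 0) {a b : ℝ} (ha : 0 < a) :
    ∫ x, ∫ σ in Ioc a b, G σ x = ∫ σ in Ioc a b, ∫ x, G σ x := by
  -- continuity in the swapped variables
  have hcont' : ContinuousOn (fun q : E × ℝ => G q.2 q.1) (univ ×ˢ Ioi (0 : ℝ)) := by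
    have hsw : ContinuousOn (fun q : E × ℝ => ((q.2, q.1) : ℝ × E)) (univ ×ˢ Ioi (0 : ℝ)) :=
      (continuous_snd.prodMk continuous_fst).continuousOn
    exact (hcont.comp hsw fun q hq => ⟨hq.2, mem_univ _⟩).congr fun q _ => rfl
  -- a uniform bound on `K × [a, b]`
  obtain ⟨C, hC⟩ : ∃ C, ∀ q ∈ K ×ˢ Icc a b, ‖(fun q : E × ℝ => G q.2 q.1) q‖ ≤ C :=
    (hK.prod isCompact_Icc).exists_bound_of_continuousOn
      (hcont'.mono (prod_mono (subset_univ _) fun σ hσ => ha.trans_le hσ.1))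
  have hbound : ∀ q : E × ℝ, q.2 ∈ Ioc a b → ‖G q.2 q.1‖ ≤ K.indicator (fun _ => C) q.1 := by
    intro q hq
    by_cases hx : q.1 ∈ K
    · rw [indicator_of_mem hx]; exact hC q ⟨hx, Ioc_subset_Icc_self hq⟩
    · rw [indicator_of_notMem hx, hzero q.2 q.1 hx, norm_zero]
  have hμ : (volume : Measure E).prod (volume.restrict (Ioc a b)) =
      ((volume : Measure E).prod volume).restrict (univ ×ˢ Ioc a b) := by
    rw [← Measure.prod_restrict, Measure.restrict_univ]
  have hint : Integrable (uncurry fun x σ => G σ x)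
      ((volume : Measure E).prod (volume.restrict (Ioc a b))) := by
    have hmeas : AEStronglyMeasurable (uncurry fun x σ => G σ x)
        ((volume : Measure E).prod (volume.restrict (Ioc a b))) := by
      rw [hμ]
      have hsub : (univ : Set E) ×ˢ Ioc a b ⊆ (univ : Set E) ×ˢ Ioi (0 : ℝ) :=
        prod_mono subset_rfl fun σ hσ => ha.trans hσ.1
      exact (hcont'.mono hsub).aestronglyMeasurable (MeasurableSet.univ.prod measurableSet_Ioc)
    have hKi : Integrable (fun x : E => K.indicator (fun _ => C) x) volume :=
      (integrableOn_const (hK.measure_lt_top.ne)).integrable_indicator hK.measurableSet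
    have hBi : Integrable (fun q : E × ℝ => K.indicator (fun _ => C) q.1 * (1 : ℝ))
        ((volume : Measure E).prod (volume.restrict (Ioc a b))) :=
      hKi.mul_prod (integrable_const (μ := volume.restrict (Ioc a b)) (1 : ℝ))
    refine hBi.mono' hmeas ?_
    rw [hμ]
    filter_upwards [ae_restrict_mem (MeasurableSet.univ.prod measurableSet_Ioc)] with q hq
    rw [mul_one]
    exact hbound q hq.2
  exact integral_integral_swap hint

/-- **Variation of the regularised pairing, bounded data.** For `h ∈ Lᵖ` (`1 ≤ p ≤ ∞`),
`Φ ∈ C²_c(E; E)` and `0 < a ≤ b`,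
`∫⟪e^{bΔ}h, Φ⟫ − ∫⟪e^{aΔ}h, Φ⟫ = ∫ₐᵇ ∫⟪e^{σΔ}h, ΔΦ⟫ dσ`
(the heat equation integrated in time, `heatExtension_sub_eq_integral_laplacian`; Fubini on
`[a, b] × supp Φ`; Green's identity `integral_inner_laplacian_comm`). [folklore] -/
theorem integral_inner_heatExtension_sub_eq_of_memLp {h : E → E} {p : ℝ≥0∞}
    (hh : MemLp h p volume) (hp : 1 ≤ p) (hΦ : ContDiff ℝ 2 Φ) (hΦc : HasCompactSupport Φ)
    {a b : ℝ} (ha : 0 < a) (hab : a ≤ b) :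
    (∫ x, ⟪heatExtension h b x, Φ x⟫) - ∫ x, ⟪heatExtension h a x, Φ x⟫ =
      ∫ σ in a..b, ∫ x, ⟪heatExtension h σ x, (Δ Φ) x⟫ := by
  haveI : CompleteSpace E := FiniteDimensional.complete ℝ E
  have hΦcont : Continuous Φ := hΦ.continuous
  have hU : ∀ σ : ℝ, 0 < σ → ContDiff ℝ 2 (heatExtension h σ) := fun σ hσ =>
    contDiff_infty.1 (contDiff_heatExtension_holds hh hp hσ) 2
  have hUc : ∀ σ : ℝ, 0 < σ → Continuous (heatExtension h σ) := fun σ hσ => (hU σ hσ).continuous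
  -- Step 1: subtract the pairings
  have i_b := integrable_inner_right _ (hUc b (ha.trans_le hab)) hΦcont hΦc
  have i_a := integrable_inner_right _ (hUc a ha) hΦcont hΦc
  rw [← integral_sub i_b i_a]
  -- Step 2: the heat equation integrated in time, inside the pairing
  have hFTC : ∀ x, heatExtension h b x - heatExtension h a x =
      ∫ σ in a..b, (Δ (heatExtension h σ)) x := fun x =>
    heatExtension_sub_eq_integral_laplacian hh hp ha hab x
  have hcontΔ : ∀ x, ContinuousOn (fun σ : ℝ => (Δ (heatExtension h σ)) x) (Icc a b) := fun x =>
    (continuousOn_laplacian_heatExtension_time hh hp x).mono fun σ hσ => ha.trans_le hσ.1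
  have hintΔ : ∀ x, IntegrableOn (fun σ : ℝ => (Δ (heatExtension h σ)) x) (Ioc a b) volume :=
    fun x => ((hcontΔ x).integrableOn_Icc).mono_set Ioc_subset_Icc_self
  have step2 : ∀ x, ⟪heatExtension h b x - heatExtension h a x, Φ x⟫ =
      ∫ σ in Ioc a b, ⟪(Δ (heatExtension h σ)) x, Φ x⟫ := by
    intro x
    rw [hFTC x, intervalIntegral.integral_of_le hab, real_inner_comm (Φ x),
      ← integral_inner (hintΔ x) (Φ x)]
    exact integral_congr_ae (Eventually.of_forall fun σ => real_inner_comm _ _)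
  have step2' : (fun x => ⟪heatExtension h b x, Φ x⟫ - ⟪heatExtension h a x, Φ x⟫) =
      fun x => ∫ σ in Ioc a b, ⟪(Δ (heatExtension h σ)) x, Φ x⟫ := by
    funext x; rw [← inner_sub_left, step2 x]
  rw [step2', intervalIntegral.integral_of_le hab]
  -- Step 3: Fubini on `E × [a, b]`
  have hcontG : ContinuousOn (fun q : ℝ × E => ⟪(Δ (heatExtension h q.1)) q.2, Φ q.2⟫)
      (Ioi 0 ×ˢ univ) :=
    (continuousOn_uncurry_laplacian_heatExtension_of_memLp hh hp).inner
      (hΦcont.comp continuous_snd).continuousOn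
  have hzero : ∀ (σ : ℝ) (x : E), x ∉ tsupport Φ →
      ⟪(Δ (heatExtension h σ)) x, Φ x⟫ = 0 := fun σ x hx => by
    rw [image_eq_zero_of_notMem_tsupport hx, inner_zero_right]
  have hswap := integral_integral_swap_Ioc_of_continuousOn (b := b) hcontG hΦc hzero ha
  rw [hswap]
  -- Step 4: Green's identity at every `σ ∈ (a, b]`
  refine setIntegral_congr_fun measurableSet_Ioc fun σ hσ => ?_
  exact integral_inner_laplacian_comm (hU σ (ha.trans hσ.1)) hΦ hΦc

end Variation


/-! ### Transfer to Gaussian-integrable data with the heat-flow bound -/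

section Gaussian

variable {Φ : E → E}

/-- **Variation of the regularised pairing.** For `f` measurable, integrable against centred
Gaussians, with `‖e^{sΔ}f‖ ≤ M s^{-1/2}`, and `Φ ∈ C²_c(E; E)`, `0 < a ≤ b`:
`∫⟪e^{bΔ}f, Φ⟫ − ∫⟪e^{aΔ}f, Φ⟫ = ∫ₐᵇ ∫⟪e^{σΔ}f, ΔΦ⟫ dσ` (the bounded-data identity
`integral_inner_heatExtension_sub_eq_of_memLp` for the datum `e^{(a/2)Δ}f ∈ L^∞` and the
semigroup law on Gaussian-integrable data). [folklore] -/
theorem integral_inner_heatExtension_sub_eq (hf : AEStronglyMeasurable f volume)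
    (hG : ∀ a : ℝ, 0 < a → Integrable (fun y => heatKernel a y * ‖f y‖) volume)
    (hM : ∀ s : ℝ, 0 < s → ∀ y, ‖heatExtension f s y‖ ≤ M * s ^ (-(1 / 2 : ℝ)))
    (hΦ : ContDiff ℝ 2 Φ) (hΦc : HasCompactSupport Φ) {a b : ℝ} (ha : 0 < a) (hab : a ≤ b) :
    (∫ x, ⟪heatExtension f b x, Φ x⟫) - ∫ x, ⟪heatExtension f a x, Φ x⟫ =
      ∫ σ in a..b, ∫ x, ⟪heatExtension f σ x, (Δ Φ) x⟫ := by
  haveI : CompleteSpace E := FiniteDimensional.complete ℝ E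
  have ha2 : 0 < a / 2 := half_pos ha
  have hh : MemLp (heatExtension f (a / 2)) ∞ volume := memLp_top_heatExtension hf hG hM ha2
  have hsg : ∀ τ : ℝ, 0 < τ → heatExtension (heatExtension f (a / 2)) τ = heatExtension f (a / 2 + τ) :=
    fun τ hτ => heatExtension_heatExtension_of_integrable_heatKernel_mul_norm hf hG ha2 hτ
  have key := integral_inner_heatExtension_sub_eq_of_memLp hh le_top hΦ hΦc ha2
    (b := b - a / 2) (by linarith)
  rw [hsg (b - a / 2) (by linarith), hsg (a / 2) ha2, show a / 2 + (b - a / 2) = b by ring,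
    add_halves] at key
  rw [key]
  set F : ℝ → ℝ := fun τ => ∫ x, ⟪heatExtension (heatExtension f (a / 2)) τ x, (Δ Φ) x⟫ with hF
  have e1 : ∫ σ in a..b, ∫ x, ⟪heatExtension f σ x, (Δ Φ) x⟫ = ∫ σ in a..b, F (σ - a / 2) := by
    refine intervalIntegral.integral_congr fun σ hσ => ?_
    rw [uIcc_of_le hab] at hσ
    simp only [hF]
    rw [hsg (σ - a / 2) (by linarith [hσ.1]), show a / 2 + (σ - a / 2) = σ by ring]
  rw [e1, intervalIntegral.integral_comp_sub_right (f := F) (a / 2), show a - a / 2 = a / 2 by ring]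

/-- Pairing a field of size `≤ B` against a test field: `|∫⟪v, Ψ⟫| ≤ B ∫‖Ψ‖`. [folklore] -/
theorem norm_integral_inner_le_of_norm_le {v Ψ : E → E} {B : ℝ} (hv : ∀ y, ‖v y‖ ≤ B)
    (hΨ : Continuous Ψ) (hΨc : HasCompactSupport Ψ) :
    ‖∫ x, ⟪v x, Ψ x⟫‖ ≤ B * ∫ x, ‖Ψ x‖ := by
  rw [← integral_const_mul]
  refine norm_integral_le_of_norm_le ((hΨ.norm.integrable_of_hasCompactSupport hΨc.norm).const_mul B)
    (Eventually.of_forall fun x => ?_)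
  exact (norm_inner_le_norm _ _).trans (mul_le_mul_of_nonneg_right (hv x) (norm_nonneg _))

/-- **The duality bound at positive times.** Under the hypotheses of
`integral_inner_heatExtension_sub_eq`, for `0 < a ≤ b`,
`|∫⟪e^{aΔ}f, Φ⟫| ≤ M (b^{-1/2} ∫‖Φ‖ + 2 b^{1/2} ∫‖ΔΦ‖)`
(`∫ₐᵇ σ^{-1/2} dσ = 2(√b − √a) ≤ 2√b`). [folklore] -/
theorem norm_integral_inner_heatExtension_le (hf : AEStronglyMeasurable f volume)
    (hG : ∀ a : ℝ, 0 < a → Integrable (fun y => heatKernel a y * ‖f y‖) volume)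
    (hM : ∀ s : ℝ, 0 < s → ∀ y, ‖heatExtension f s y‖ ≤ M * s ^ (-(1 / 2 : ℝ)))
    (hΦ : ContDiff ℝ 2 Φ) (hΦc : HasCompactSupport Φ) {a b : ℝ} (ha : 0 < a) (hab : a ≤ b) :
    ‖∫ x, ⟪heatExtension f a x, Φ x⟫‖ ≤
      M * (b ^ (-(1 / 2 : ℝ)) * (∫ x, ‖Φ x‖) + 2 * b ^ (1 / 2 : ℝ) * ∫ x, ‖(Δ Φ) x‖) := by
  have hb : 0 < b := ha.trans_le hab
  have hM0 : 0 ≤ M := by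
    have h := (norm_nonneg _).trans (hM 1 one_pos 0)
    rwa [Real.one_rpow, mul_one] at h
  have hΦcont : Continuous Φ := hΦ.continuous
  have hΔΦcont : Continuous (Δ Φ) := continuous_laplacian hΦ
  have hΔΦc : HasCompactSupport (Δ Φ) := hΦc.mono' fun x hx => by
    by_contra h'
    exact hx (laplacian_eq_zero_of_notMem_tsupport h')
  set L₂ : ℝ := ∫ x, ‖(Δ Φ) x‖ with hL₂
  have hL₂0 : 0 ≤ L₂ := integral_nonneg fun x => norm_nonneg _
  have key := integral_inner_heatExtension_sub_eq hf hG hM hΦ hΦc ha hab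
  have eq_a : ∫ x, ⟪heatExtension f a x, Φ x⟫ =
      (∫ x, ⟪heatExtension f b x, Φ x⟫) - ∫ σ in a..b, ∫ x, ⟪heatExtension f σ x, (Δ Φ) x⟫ := by
    rw [← key]; ring
  -- the two terms
  have h1 : ‖∫ x, ⟪heatExtension f b x, Φ x⟫‖ ≤ M * b ^ (-(1 / 2 : ℝ)) * ∫ x, ‖Φ x‖ :=
    norm_integral_inner_le_of_norm_le (hM b hb) hΦcont hΦc
  have h2 : ‖∫ σ in a..b, ∫ x, ⟪heatExtension f σ x, (Δ Φ) x⟫‖ ≤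
      ∫ σ in a..b, M * σ ^ (-(1 / 2 : ℝ)) * L₂ := by
    refine intervalIntegral.norm_integral_le_of_norm_le hab
      (Eventually.of_forall fun σ hσ => ?_) ?_
    · exact norm_integral_inner_le_of_norm_le (hM σ (ha.trans hσ.1)) hΔΦcont hΔΦc
    · refine ContinuousOn.intervalIntegrable ?_
      rw [uIcc_of_le hab]
      refine (continuousOn_const.mul (continuousOn_id.rpow_const fun σ hσ => ?_)).mul
        continuousOn_const
      exact Or.inl (ne_of_gt (ha.trans_le hσ.1))
  have h3 : ∫ σ in a..b, M * σ ^ (-(1 / 2 : ℝ)) * L₂ ≤ 2 * b ^ (1 / 2 : ℝ) * (M * L₂) := by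
    have hint : ∫ σ in a..b, σ ^ (-(1 / 2 : ℝ)) = (b ^ (1 / 2 : ℝ) - a ^ (1 / 2 : ℝ)) / (1 / 2) := by
      have h0 : (0 : ℝ) ∉ uIcc a b := by
        rw [uIcc_of_le hab]; exact fun h => (lt_irrefl _ (ha.trans_le h.1))
      have := integral_rpow (a := a) (b := b) (r := -(1 / 2 : ℝ)) (Or.inr ⟨by norm_num, h0⟩)
      rw [this]; norm_num
    have e : ∫ σ in a..b, M * σ ^ (-(1 / 2 : ℝ)) * L₂ = M * L₂ * ∫ σ in a..b, σ ^ (-(1 / 2 : ℝ)) := by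
      rw [← intervalIntegral.integral_const_mul]
      exact intervalIntegral.integral_congr fun σ _ => by ring
    rw [e, hint]
    have ha' : 0 ≤ a ^ (1 / 2 : ℝ) := Real.rpow_nonneg ha.le _
    have hML : 0 ≤ M * L₂ := mul_nonneg hM0 hL₂0
    nlinarith [mul_nonneg hML ha']
  calc ‖∫ x, ⟪heatExtension f a x, Φ x⟫‖
      = ‖(∫ x, ⟪heatExtension f b x, Φ x⟫) -
          ∫ σ in a..b, ∫ x, ⟪heatExtension f σ x, (Δ Φ) x⟫‖ := by rw [eq_a]
    _ ≤ ‖∫ x, ⟪heatExtension f b x, Φ x⟫‖ +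
          ‖∫ σ in a..b, ∫ x, ⟪heatExtension f σ x, (Δ Φ) x⟫‖ := norm_sub_le _ _
    _ ≤ M * b ^ (-(1 / 2 : ℝ)) * (∫ x, ‖Φ x‖) + 2 * b ^ (1 / 2 : ℝ) * (M * L₂) :=
        add_le_add h1 (h2.trans h3)
    _ = M * (b ^ (-(1 / 2 : ℝ)) * (∫ x, ‖Φ x‖) + 2 * b ^ (1 / 2 : ℝ) * L₂) := by ring

end Gaussian

/-! ### The limit `a → 0⁺`: `∫⟪f, e^{aΔ}Φ⟫ → ∫⟪f, Φ⟫` -/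

section Limit

/-- **Gaussian far-field bound for the caloric extension of a compactly supported field**: if
`‖Φ‖ ≤ C_Φ`, `supp Φ ⊆ B̄(0, ρ)`, `0 < a ≤ 1` and `‖y‖ ≥ ρ + 1`, then
`‖e^{aΔ}Φ(y)‖ ≤ C_Φ |B̄(0,ρ)| · (4πa)^{-d/2} e^{-1/(8a)} · e^{ρ²/8} e^{-‖y‖²/32}`
(off-diagonal smallness of the heat kernel, `heatKernel_le_of_le_norm`). [folklore] -/
theorem norm_heatExtension_le_of_far {Φ : E → E} {CΦ ρ : ℝ} (hCΦ : ∀ z, ‖Φ z‖ ≤ CΦ)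
    (hsupp : tsupport Φ ⊆ closedBall (0 : E) ρ) {a : ℝ} (ha : 0 < a) (ha1 : a ≤ 1)
    {y : E} (hy : ρ + 1 ≤ ‖y‖) :
    ‖heatExtension Φ a y‖ ≤
      CΦ * volume.real (closedBall (0 : E) ρ) *
        ((4 * Real.pi * a) ^ (-(Module.finrank ℝ E : ℝ) / 2) * Real.exp (-(1 ^ 2 / (8 * a)))) *
        (Real.exp (ρ ^ 2 / 8) * Real.exp (-(1 / 32) * ‖y‖ ^ 2)) := by
  set P : ℝ := (4 * Real.pi * a) ^ (-(Module.finrank ℝ E : ℝ) / 2) * Real.exp (-(1 ^ 2 / (8 * a)))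
    with hP
  set Q : ℝ := Real.exp (ρ ^ 2 / 8) * Real.exp (-(1 / 32) * ‖y‖ ^ 2) with hQ
  have hP0 : 0 ≤ P := by rw [hP]; positivity
  have hCΦ0 : 0 ≤ CΦ := (norm_nonneg _).trans (hCΦ 0)
  rw [Literature.Analysis.UnboundedOperators.heatExtension_eq_integral_sub,
    ← setIntegral_eq_integral_of_forall_compl_eq_zero (s := closedBall (0 : E) ρ)]
  swap
  · intro w hw
    rw [image_eq_zero_of_notMem_tsupport (fun h => hw (hsupp h)), smul_zero]
  have key : ∀ w ∈ closedBall (0 : E) ρ, ‖heatKernel a (y - w) • Φ w‖ ≤ P * Q * CΦ := by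
    intro w hw
    rw [mem_closedBall, dist_zero_right] at hw
    have hyw : 1 ≤ ‖y - w‖ := by
      have := norm_sub_norm_le y w
      linarith
    have hyw' : ‖y‖ - ρ ≤ ‖y - w‖ := by
      have := norm_sub_norm_le y w
      linarith
    have hK := heatKernel_le_of_le_norm ha ha1 zero_le_one hyw
    have hexp : Real.exp (-(1 / 8) * ‖y - w‖ ^ 2) ≤ Q := by
      rw [hQ, ← Real.exp_add]
      refine Real.exp_le_exp.2 ?_
      have h1 : (‖y‖ - ρ) ^ 2 ≤ ‖y - w‖ ^ 2 := pow_le_pow_left₀ (by linarith) hyw' 2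
      nlinarith [sq_nonneg (3 * ‖y‖ - 4 * ρ), sq_nonneg ρ]
    rw [norm_smul, Real.norm_of_nonneg (heatKernel_pos ha _).le]
    calc heatKernel a (y - w) * ‖Φ w‖ ≤ (P * Real.exp (-(1 / 8) * ‖y - w‖ ^ 2)) * CΦ :=
          mul_le_mul hK (hCΦ w) (norm_nonneg _) (mul_nonneg hP0 (Real.exp_pos _).le)
      _ ≤ (P * Q) * CΦ := by gcongr
  calc ‖∫ w in closedBall (0 : E) ρ, heatKernel a (y - w) • Φ w‖
      ≤ (P * Q * CΦ) * volume.real (closedBall (0 : E) ρ) :=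
        norm_setIntegral_le_of_norm_le_const measure_closedBall_lt_top key
    _ = CΦ * volume.real (closedBall (0 : E) ρ) * P * Q := by ring

/-- **Weak continuity of the heat flow at `t = 0` against Gaussian-integrable fields**: for
`f` measurable and integrable against centred Gaussians and `Φ` continuous with compact
support, `∫⟪f, e^{aΔ}Φ⟫ → ∫⟪f, Φ⟫` as `a → 0⁺` (dominated convergence: `e^{aΔ}Φ → Φ`
pointwise, `‖e^{aΔ}Φ‖ ≤ ‖Φ‖_∞` near the support and a fixed Gaussian away from it).
[folklore] -/
theorem tendsto_integral_inner_heatExtension_nhdsGT_zero (hf : AEStronglyMeasurable f volume)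
    (hG : ∀ a : ℝ, 0 < a → Integrable (fun y => heatKernel a y * ‖f y‖) volume)
    {Φ : E → E} (hΦ : Continuous Φ) (hΦc : HasCompactSupport Φ) :
    Tendsto (fun a : ℝ => ∫ y, ⟪f y, heatExtension Φ a y⟫) (𝓝[>] 0)
      (𝓝 (∫ y, ⟪f y, Φ y⟫)) := by
  haveI : CompleteSpace E := FiniteDimensional.complete ℝ E
  set d : ℝ := (Module.finrank ℝ E : ℝ) with hd
  obtain ⟨CΦ, hCΦ⟩ := hΦ.bounded_above_of_compact_support hΦc
  have hCΦ0 : 0 ≤ CΦ := (norm_nonneg _).trans (hCΦ 0)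
  obtain ⟨r, hr⟩ := hΦc.isBounded.subset_closedBall (0 : E)
  set ρ : ℝ := max r 0 with hρ
  have hρ0 : 0 ≤ ρ := le_max_right _ _
  have hsupp : tsupport Φ ⊆ closedBall (0 : E) ρ := hr.trans (closedBall_subset_closedBall (le_max_left _ _))
  -- the off-diagonal prefactor is eventually `≤ 1`
  set P : ℝ → ℝ := fun a => (4 * Real.pi * a) ^ (-d / 2) * Real.exp (-(1 ^ 2 / (8 * a))) with hPdef
  have hPlim : Tendsto P (𝓝[>] 0) (𝓝 0) := tendsto_offDiagonal_factor (E := E) one_pos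
  have hP1 : ∀ᶠ a in 𝓝[>] (0 : ℝ), P a < 1 := (tendsto_order.1 hPlim).2 1 one_pos
  -- the dominating function
  set V : ℝ := volume.real (closedBall (0 : E) ρ) with hV
  set D : ℝ := CΦ * V * Real.exp (ρ ^ 2 / 8) * (4 * Real.pi * 8) ^ (d / 2) with hD
  have hD0 : 0 ≤ D := by rw [hD]; positivity
  set bound : E → ℝ := fun y =>
    CΦ * (closedBall (0 : E) (ρ + 1)).indicator (fun y => ‖f y‖) y + D * (heatKernel 8 y * ‖f y‖)
    with hbound
  have hbound_int : Integrable bound volume := by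
    refine Integrable.add ?_ ((hG 8 (by norm_num)).const_mul D)
    exact (IntegrableOn.integrable_indicator
      (integrableOn_of_integrable_heatKernel_mul_norm (R := ρ + 1) hf hG).norm
      measurableSet_closedBall).const_mul CΦ
  -- the Gaussian `e^{-‖y‖²/32}` as a multiple of `heatKernel 8`
  have hK8 : ∀ y : E, Real.exp (-(1 / 32) * ‖y‖ ^ 2) = (4 * Real.pi * 8) ^ (d / 2) * heatKernel 8 y := by
    intro y
    rw [heatKernel_eq, ← hd, ← mul_assoc, show -d / 2 = -(d / 2) by ring, Real.rpow_neg (by positivity),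
      mul_inv_cancel₀ (by positivity), one_mul]
    norm_num
  refine tendsto_integral_filter_of_dominated_convergence bound ?_ ?_ hbound_int ?_
  · filter_upwards [self_mem_nhdsWithin] with a ha
    exact hf.inner (contDiff_heatExtension_of_bound (m := 0) hΦ hCΦ ha).continuous.aestronglyMeasurable
  · filter_upwards [Ioc_mem_nhdsGT one_pos, hP1] with a ha hPa
    refine Eventually.of_forall fun y => ?_
    refine (norm_inner_le_norm _ _).trans ?_
    by_cases hy : y ∈ closedBall (0 : E) (ρ + 1)
    · rw [hbound]; dsimp only
      rw [indicator_of_mem hy]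
      have h1 : ‖f y‖ * ‖heatExtension Φ a y‖ ≤ CΦ * ‖f y‖ := by
        rw [mul_comm]
        exact mul_le_mul_of_nonneg_right (norm_heatExtension_le hCΦ ha.1 y) (norm_nonneg _)
      have h2 : 0 ≤ D * (heatKernel 8 y * ‖f y‖) :=
        mul_nonneg hD0 (mul_nonneg (heatKernel_pos (by norm_num) y).le (norm_nonneg _))
      linarith
    · rw [mem_closedBall, dist_zero_right, not_le] at hy
      have hfar := norm_heatExtension_le_of_far hCΦ hsupp ha.1 ha.2 hy.le
      rw [hbound]; dsimp only
      rw [indicator_of_notMem (by rwa [mem_closedBall, dist_zero_right, not_le]), mul_zero, zero_add]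
      have ha0 : 0 < a := ha.1
      have hP0 : 0 ≤ P a := by simp only [hPdef]; positivity
      have h3 : ‖heatExtension Φ a y‖ ≤ D * heatKernel 8 y := by
        refine hfar.trans ?_
        rw [hK8 y, hD]
        have : CΦ * V * P a * (Real.exp (ρ ^ 2 / 8) * ((4 * Real.pi * 8) ^ (d / 2) * heatKernel 8 y)) =
            P a * (CΦ * V * Real.exp (ρ ^ 2 / 8) * (4 * Real.pi * 8) ^ (d / 2) * heatKernel 8 y) := by
          ring
        rw [this]
        have hR : 0 ≤ CΦ * V * Real.exp (ρ ^ 2 / 8) * (4 * Real.pi * 8) ^ (d / 2) * heatKernel 8 y :=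
          mul_nonneg (by positivity) (heatKernel_pos (by norm_num) y).le
        calc P a * _ ≤ 1 * _ := mul_le_mul_of_nonneg_right hPa.le hR
          _ = _ := one_mul _
      calc ‖f y‖ * ‖heatExtension Φ a y‖ ≤ ‖f y‖ * (D * heatKernel 8 y) :=
            mul_le_mul_of_nonneg_left h3 (norm_nonneg _)
        _ = D * (heatKernel 8 y * ‖f y‖) := by ring
  · refine Eventually.of_forall fun y => ?_
    have hmem : MemLp Φ 2 volume := hΦ.memLp_of_hasCompactSupport hΦc
    exact tendsto_const_nhds.inner
      (tendsto_heatExtension_nhdsGT_zero_of_continuousAt hmem (by norm_num) hΦ.continuousAt)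

end Limit


/-! ### The duality bound -/

section Main

variable {Φ : E → E}

/-- **The heat-flow duality bound** (the tree's substitute for Seregin–Zhou 2020, Lemma 2.2):
let `f : E → E` be a.e. strongly measurable, integrable against every centred Gaussian, with
`‖e^{sΔ}f(y)‖ ≤ M s^{-1/2}` for all `s > 0`, `y` (i.e. `‖f‖_{Ḃ^{-1}_{∞,∞}} ≤ M` in the heat-flow
norm of Seregin–Zhou 2020, p. 2). Then for every `Φ ∈ C²_c(E; E)` and `t > 0`,
`|∫⟪f, Φ⟫| ≤ M (t^{-1/2} ∫‖Φ‖ + 2 t^{1/2} ∫‖ΔΦ‖)`.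
[cite: SereginZhou2020, §1 (heat-flow definition of the Ḃ^{-1}_{∞,∞} norm, p. 2) and Lemma 2.2 (cut-off), for which this is the duality substitute] -/
theorem norm_integral_inner_le_of_heatExtension_bound (hf : AEStronglyMeasurable f volume)
    (hG : ∀ a : ℝ, 0 < a → Integrable (fun y => heatKernel a y * ‖f y‖) volume)
    (hM : ∀ s : ℝ, 0 < s → ∀ y, ‖heatExtension f s y‖ ≤ M * s ^ (-(1 / 2 : ℝ)))
    (hΦ : ContDiff ℝ 2 Φ) (hΦc : HasCompactSupport Φ) {t : ℝ} (ht : 0 < t) :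
    ‖∫ x, ⟪f x, Φ x⟫‖ ≤
      M * (t ^ (-(1 / 2 : ℝ)) * (∫ x, ‖Φ x‖) + 2 * t ^ (1 / 2 : ℝ) * ∫ x, ‖(Δ Φ) x‖) := by
  have hlim := (tendsto_integral_inner_heatExtension_nhdsGT_zero hf hG hΦ.continuous hΦc).norm
  refine le_of_tendsto hlim ?_
  filter_upwards [Ioc_mem_nhdsGT ht] with a ha
  rw [← (integral_inner_heatExtension_comm_of_integrable_heatKernel hf hG hΦ.continuous hΦc ha.1).2]
  exact norm_integral_inner_heatExtension_le hf hG hM hΦ hΦc ha.1 ha.2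

end Main

/-! ### The localised kernel test function `y ↦ G_t(y − x) φ(y)` -/

section Cutoff

omit [MeasurableSpace E] [BorelSpace E] in
/-- `|Δψ| ≤ d ‖D²ψ‖` for a `C²` scalar function (`Δψ = Σᵢ D²ψ(eᵢ, eᵢ)`). [folklore] -/
theorem abs_laplacian_le_mul_norm_iteratedFDeriv (ψ : E → ℝ) (y : E) :
    |(Δ ψ) y| ≤ Module.finrank ℝ E * ‖iteratedFDeriv ℝ 2 ψ y‖ := by
  set b := stdOrthonormalBasis ℝ E
  rw [laplacian_eq_iteratedFDeriv_orthonormalBasis ψ b]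
  dsimp only
  refine (Finset.abs_sum_le_sum_abs _ _).trans ?_
  have hterm : ∀ i, |iteratedFDeriv ℝ 2 ψ y ![b i, b i]| ≤ ‖iteratedFDeriv ℝ 2 ψ y‖ := fun i => by
    have h := (iteratedFDeriv ℝ 2 ψ y).le_opNorm ![b i, b i]
    rw [Fin.prod_univ_two] at h
    simp only [Matrix.cons_val_zero, Matrix.cons_val_one, b.orthonormal.1,
      mul_one, Real.norm_eq_abs] at h
    exact h
  calc ∑ i, |iteratedFDeriv ℝ 2 ψ y ![b i, b i]|
      ≤ ∑ _i : Fin (Module.finrank ℝ E), ‖iteratedFDeriv ℝ 2 ψ y‖ :=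
        Finset.sum_le_sum fun i _ => hterm i
    _ = Module.finrank ℝ E * ‖iteratedFDeriv ℝ 2 ψ y‖ := by
        rw [Finset.sum_const, Finset.card_univ, Fintype.card_fin, nsmul_eq_mul]

omit [FiniteDimensional ℝ E] [MeasurableSpace E] [BorelSpace E] in
/-- **Second derivatives of the localised kernel.** For `ψ(y) = G_t(y − x) φ(y)` with `φ ∈ C²`,
`|φ| ≤ 1`, `‖Dφ‖ ≤ c₁/r`, `‖D²φ‖ ≤ c₂/r²` (pointwise Leibniz bound,
`norm_iteratedFDeriv_mul_le`). [folklore] -/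
theorem norm_iteratedFDeriv_two_kernel_mul_le {φ : E → ℝ} (hφ : ContDiff ℝ 2 φ) {c₁ c₂ r : ℝ}
    (h0 : ∀ y, |φ y| ≤ 1) (h1 : ∀ y, ‖iteratedFDeriv ℝ 1 φ y‖ ≤ c₁ / r)
    (h2 : ∀ y, ‖iteratedFDeriv ℝ 2 φ y‖ ≤ c₂ / r ^ 2) {t : ℝ} (ht : 0 < t) (x y : E) :
    ‖iteratedFDeriv ℝ 2 (fun y => heatKernel t (y - x) * φ y) y‖ ≤
      heatKernel t (y - x) * (c₂ / r ^ 2) +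
        2 * ‖iteratedFDeriv ℝ 1 (heatKernel t) (y - x)‖ * (c₁ / r) +
        ‖iteratedFDeriv ℝ 2 (heatKernel t) (y - x)‖ := by
  have hu : ContDiff ℝ 2 (fun y : E => heatKernel t (y - x)) :=
    (FunctionSpaces.contDiff_heatKernel' t).comp (contDiff_id.sub contDiff_const)
  have key := norm_iteratedFDeriv_mul_le hu hφ y (n := 2) le_rfl
  have e0 : ∀ i, iteratedFDeriv ℝ i (fun y : E => heatKernel t (y - x)) y =
      iteratedFDeriv ℝ i (heatKernel t) (y - x) := fun i => iteratedFDeriv_comp_sub i x y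
  simp only [Finset.sum_range_succ, Finset.sum_range_zero, zero_add, e0, Nat.choose_zero_right,
    Nat.cast_one, one_mul, Nat.sub_zero, norm_iteratedFDeriv_zero,
    show Nat.choose 2 1 = 2 by rfl, show Nat.choose 2 2 = 1 by rfl, Nat.cast_ofNat] at key
  have hK0 : 0 ≤ heatKernel t (y - x) := (heatKernel_pos ht _).le
  have key' : ‖iteratedFDeriv ℝ 2 (fun y => heatKernel t (y - x) * φ y) y‖ ≤
      ‖heatKernel t (y - x)‖ * ‖iteratedFDeriv ℝ 2 φ y‖ +
        2 * ‖iteratedFDeriv ℝ 1 (heatKernel t) (y - x)‖ * ‖iteratedFDeriv ℝ 1 φ y‖ +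
        ‖iteratedFDeriv ℝ 2 (heatKernel t) (y - x)‖ * ‖iteratedFDeriv ℝ 0 φ y‖ := key
  rw [norm_iteratedFDeriv_zero, Real.norm_of_nonneg hK0, Real.norm_eq_abs] at key'
  refine key'.trans ?_
  have hD1 : 0 ≤ ‖iteratedFDeriv ℝ 1 (heatKernel t) (y - x)‖ := norm_nonneg _
  have hD2 : 0 ≤ ‖iteratedFDeriv ℝ 2 (heatKernel t) (y - x)‖ := norm_nonneg _
  calc heatKernel t (y - x) * ‖iteratedFDeriv ℝ 2 φ y‖ +
        2 * ‖iteratedFDeriv ℝ 1 (heatKernel t) (y - x)‖ * ‖iteratedFDeriv ℝ 1 φ y‖ +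
        ‖iteratedFDeriv ℝ 2 (heatKernel t) (y - x)‖ * |φ y|
      ≤ heatKernel t (y - x) * (c₂ / r ^ 2) +
        2 * ‖iteratedFDeriv ℝ 1 (heatKernel t) (y - x)‖ * (c₁ / r) +
        ‖iteratedFDeriv ℝ 2 (heatKernel t) (y - x)‖ * 1 := by
        gcongr
        · exact h2 y
        · exact h1 y
        · exact h0 y
    _ = _ := by rw [mul_one]

/-- **`L¹` bound for the Laplacian of the localised kernel.** With `ψ(y) = G_t(y − x) φ(y)`,
`φ ∈ C²`, `|φ| ≤ 1`, `‖Dφ‖ ≤ c₁/r`, `‖D²φ‖ ≤ c₂/r²`, `0 ≤ c₁, c₂`, and `0 < t ≤ r²`: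
`∫ |Δψ| ≤ d (c₂ + 2 c₁ A₁ + A₂) / t`, where `Aₖ = ∫ ‖Dᵏ G_1‖` (`L¹` scaling of the kernel
derivatives, `Literature.Analysis.FunctionSpaces.integral_norm_iteratedFDeriv_heatKernel_eq`).
[folklore] -/
theorem integral_abs_laplacian_kernel_mul_le {φ : E → ℝ} (hφ : ContDiff ℝ 2 φ) {c₁ c₂ r : ℝ}
    (hc₁ : 0 ≤ c₁) (hc₂ : 0 ≤ c₂) (hr : 0 < r) (h0 : ∀ y, |φ y| ≤ 1)
    (h1 : ∀ y, ‖iteratedFDeriv ℝ 1 φ y‖ ≤ c₁ / r) (h2 : ∀ y, ‖iteratedFDeriv ℝ 2 φ y‖ ≤ c₂ / r ^ 2)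
    {t : ℝ} (ht : 0 < t) (htr : t ≤ r ^ 2) (x : E) :
    ∫ y, |(Δ (fun y => heatKernel t (y - x) * φ y)) y| ≤
      Module.finrank ℝ E * (c₂ + 2 * c₁ * (∫ y, ‖iteratedFDeriv ℝ 1 (heatKernel (E := E) 1) y‖) +
        ∫ y, ‖iteratedFDeriv ℝ 2 (heatKernel (E := E) 1) y‖) / t := by
  set d : ℝ := (Module.finrank ℝ E : ℝ) with hd
  set A₁ : ℝ := ∫ y, ‖iteratedFDeriv ℝ 1 (heatKernel (E := E) 1) y‖ with hA₁
  set A₂ : ℝ := ∫ y, ‖iteratedFDeriv ℝ 2 (heatKernel (E := E) 1) y‖ with hA₂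
  have hA₁0 : 0 ≤ A₁ := integral_nonneg fun y => norm_nonneg _
  have hA₂0 : 0 ≤ A₂ := integral_nonneg fun y => norm_nonneg _
  have hd0 : 0 ≤ d := by rw [hd]; positivity
  -- the integrable majorant
  set m : E → ℝ := fun z => heatKernel t z * (c₂ / r ^ 2) +
    2 * ‖iteratedFDeriv ℝ 1 (heatKernel t) z‖ * (c₁ / r) + ‖iteratedFDeriv ℝ 2 (heatKernel t) z‖ with hm
  have hm_int : Integrable m := by
    refine Integrable.add (Integrable.add ?_ ?_) ?_
    · exact (integrable_heatKernel_holds ht).mul_const _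
    · have := (FunctionSpaces.integrable_iteratedFDeriv_heatKernel (E := E) ht 1).norm
      simpa [mul_assoc, mul_comm, mul_left_comm] using (this.const_mul 2).mul_const (c₁ / r)
    · exact (FunctionSpaces.integrable_iteratedFDeriv_heatKernel (E := E) ht 2).norm
  have hpt : ∀ y, |(Δ (fun y => heatKernel t (y - x) * φ y)) y| ≤ d * m (y - x) := fun y =>
    (abs_laplacian_le_mul_norm_iteratedFDeriv _ y).trans
      (mul_le_mul_of_nonneg_left (norm_iteratedFDeriv_two_kernel_mul_le hφ h0 h1 h2 ht x y) hd0)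
  -- integrate
  have hmx : Integrable (fun y => d * m (y - x)) := (hm_int.comp_sub_right x).const_mul d
  have step1 : ∫ y, |(Δ (fun y => heatKernel t (y - x) * φ y)) y| ≤ ∫ y, d * m (y - x) :=
    integral_mono_of_nonneg (Eventually.of_forall fun y => abs_nonneg _) hmx
      (Eventually.of_forall hpt)
  have iA : Integrable (fun z : E => heatKernel t z * (c₂ / r ^ 2)) :=
    (integrable_heatKernel_holds ht).mul_const _
  have iB : Integrable (fun z : E => 2 * ‖iteratedFDeriv ℝ 1 (heatKernel t) z‖ * (c₁ / r)) := by
    have := (FunctionSpaces.integrable_iteratedFDeriv_heatKernel (E := E) ht 1).norm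
    simpa [mul_assoc, mul_comm, mul_left_comm] using (this.const_mul 2).mul_const (c₁ / r)
  have iC : Integrable (fun z : E => ‖iteratedFDeriv ℝ 2 (heatKernel t) z‖) :=
    (FunctionSpaces.integrable_iteratedFDeriv_heatKernel (E := E) ht 2).norm
  have eA : ∫ z : E, heatKernel t z * (c₂ / r ^ 2) = c₂ / r ^ 2 := by
    rw [integral_mul_const, integral_heatKernel_eq_one_holds ht, one_mul]
  have eB : ∫ z : E, 2 * ‖iteratedFDeriv ℝ 1 (heatKernel t) z‖ * (c₁ / r) =
      2 * (c₁ / r) * ((Real.sqrt t)⁻¹ * A₁) := by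
    rw [show (fun z : E => 2 * ‖iteratedFDeriv ℝ 1 (heatKernel t) z‖ * (c₁ / r)) =
        fun z => (2 * (c₁ / r)) * ‖iteratedFDeriv ℝ 1 (heatKernel t) z‖ from funext fun z => by ring,
      integral_const_mul, FunctionSpaces.integral_norm_iteratedFDeriv_heatKernel_eq ht 1, pow_one]
  have eC : ∫ z : E, ‖iteratedFDeriv ℝ 2 (heatKernel t) z‖ = (Real.sqrt t)⁻¹ ^ 2 * A₂ :=
    FunctionSpaces.integral_norm_iteratedFDeriv_heatKernel_eq ht 2
  have em : ∫ z, m z = c₂ / r ^ 2 + 2 * (c₁ / r) * ((Real.sqrt t)⁻¹ * A₁) + (Real.sqrt t)⁻¹ ^ 2 * A₂ := by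
    have hadd1 := integral_add iA iB
    have hadd2 := integral_add (iA.add iB) iC
    simp only [Pi.add_apply] at hadd2
    simp only [hm]
    rw [hadd2, hadd1, eA, eB, eC]
  have step2 : ∫ y, d * m (y - x) = d * (c₂ / r ^ 2 + 2 * (c₁ / r) * ((Real.sqrt t)⁻¹ * A₁) +
      (Real.sqrt t)⁻¹ ^ 2 * A₂) := by
    rw [integral_const_mul, integral_sub_right_eq_self m x, em]
  -- compare with `1/t`
  have hst : Real.sqrt t ≤ r := by
    rw [Real.sqrt_le_left hr.le]; exact htr
  have hs0 : 0 < Real.sqrt t := Real.sqrt_pos.2 ht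
  have e2 : (Real.sqrt t)⁻¹ ^ 2 = t⁻¹ := by rw [inv_pow, Real.sq_sqrt ht.le]
  have i1 : c₂ / r ^ 2 ≤ c₂ / t := div_le_div_of_nonneg_left hc₂ ht htr
  have i2 : c₁ / r * (Real.sqrt t)⁻¹ ≤ c₁ / t := by
    rw [div_mul_eq_mul_div, div_le_div_iff₀ (by positivity) ht]
    have : (Real.sqrt t)⁻¹ * t = Real.sqrt t := by
      rw [inv_mul_eq_div, div_eq_iff hs0.ne', ← pow_two, Real.sq_sqrt ht.le]  -- t/√t = √t
    calc c₁ * (Real.sqrt t)⁻¹ * t = c₁ * ((Real.sqrt t)⁻¹ * t) := by ring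
      _ = c₁ * Real.sqrt t := by rw [this]
      _ ≤ c₁ * r := mul_le_mul_of_nonneg_left hst hc₁
  calc ∫ y, |(Δ (fun y => heatKernel t (y - x) * φ y)) y| ≤ ∫ y, d * m (y - x) := step1
    _ = d * (c₂ / r ^ 2 + 2 * (c₁ / r) * ((Real.sqrt t)⁻¹ * A₁) + (Real.sqrt t)⁻¹ ^ 2 * A₂) := step2
    _ = d * (c₂ / r ^ 2 + 2 * (c₁ / r * (Real.sqrt t)⁻¹) * A₁ + t⁻¹ * A₂) := by rw [e2]; ring
    _ ≤ d * (c₂ / t + 2 * (c₁ / t) * A₁ + t⁻¹ * A₂) := by gcongr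
    _ = d * (c₂ + 2 * c₁ * A₁ + A₂) / t := by field_simp

/-- A continuous compactly supported scalar function times a field integrable against centred
Gaussians is integrable. [folklore] -/
theorem integrable_smul_of_hasCompactSupport {ψ : E → ℝ} (hψ : Continuous ψ) (hψc : HasCompactSupport ψ)
    (hf : AEStronglyMeasurable f volume)
    (hG : ∀ a : ℝ, 0 < a → Integrable (fun y => heatKernel a y * ‖f y‖) volume) :
    Integrable (fun y => ψ y • f y) volume := by
  obtain ⟨C, hC⟩ := hψ.bounded_above_of_compact_support hψc
  obtain ⟨R, hR⟩ := hψc.isBounded.subset_closedBall (0 : E)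
  have hI := IntegrableOn.integrable_indicator
    (integrableOn_of_integrable_heatKernel_mul_norm (R := R) hf hG).norm measurableSet_closedBall
  refine (hI.const_mul C).mono' (hψ.aestronglyMeasurable.smul hf) (Eventually.of_forall fun y => ?_)
  by_cases hy : y ∈ closedBall (0 : E) R
  · rw [indicator_of_mem hy, norm_smul]
    exact mul_le_mul_of_nonneg_right (hC y) (norm_nonneg _)
  · rw [image_eq_zero_of_notMem_tsupport (fun h => hy (hR h)), zero_smul, norm_zero,
      indicator_of_notMem hy, mul_zero]

/-- **Heat flow of a cut-off of a `Ḃ^{-1}_{∞,∞}`-bounded field** (the localisation step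
replacing Seregin–Zhou 2020, Lemma 2.2): let `f : E → E` be a.e. strongly measurable, integrable
against centred Gaussians, with `‖e^{sΔ}f(y)‖ ≤ M s^{-1/2}`; let `φ ∈ C²_c(E; ℝ)` with
`|φ| ≤ 1`, `‖Dφ‖ ≤ c₁/r`, `‖D²φ‖ ≤ c₂/r²`. Then for `0 < t ≤ r²` and every `x`,
`‖e^{tΔ}(φ f)(x)‖ ≤ (1 + 2 d (c₂ + 2 c₁ A₁ + A₂)) M t^{-1/2}`, `Aₖ = ∫‖Dᵏ G_1‖`, `d = dim E`
(duality: `‖e^{tΔ}(φf)(x)‖² = ∫⟪f, G_t(· − x) φ e^{tΔ}(φf)(x)⟫` and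
`norm_integral_inner_le_of_heatExtension_bound`).
[cite: SereginZhou2020, Lemma 2.2 (cut-off in Ḃ^{-1}_{∞,∞}), duality substitute at times t ≤ r²] -/
theorem norm_heatExtension_cutoff_smul_le (hf : AEStronglyMeasurable f volume)
    (hG : ∀ a : ℝ, 0 < a → Integrable (fun y => heatKernel a y * ‖f y‖) volume)
    (hM : ∀ s : ℝ, 0 < s → ∀ y, ‖heatExtension f s y‖ ≤ M * s ^ (-(1 / 2 : ℝ)))
    {φ : E → ℝ} (hφ : ContDiff ℝ 2 φ) (hφc : HasCompactSupport φ) {c₁ c₂ r : ℝ}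
    (hc₁ : 0 ≤ c₁) (hc₂ : 0 ≤ c₂) (hr : 0 < r) (h0 : ∀ y, |φ y| ≤ 1)
    (h1 : ∀ y, ‖iteratedFDeriv ℝ 1 φ y‖ ≤ c₁ / r) (h2 : ∀ y, ‖iteratedFDeriv ℝ 2 φ y‖ ≤ c₂ / r ^ 2)
    {t : ℝ} (ht : 0 < t) (htr : t ≤ r ^ 2) (x : E) :
    ‖heatExtension (fun y => φ y • f y) t x‖ ≤
      (1 + 2 * (Module.finrank ℝ E * (c₂ + 2 * c₁ * (∫ y, ‖iteratedFDeriv ℝ 1 (heatKernel (E := E) 1) y‖) +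
        ∫ y, ‖iteratedFDeriv ℝ 2 (heatKernel (E := E) 1) y‖))) * M * t ^ (-(1 / 2 : ℝ)) := by
  haveI : CompleteSpace E := FiniteDimensional.complete ℝ E
  set B : ℝ := Module.finrank ℝ E * (c₂ + 2 * c₁ * (∫ y, ‖iteratedFDeriv ℝ 1 (heatKernel (E := E) 1) y‖) +
    ∫ y, ‖iteratedFDeriv ℝ 2 (heatKernel (E := E) 1) y‖) with hB
  have hB0 : 0 ≤ B := by
    rw [hB]
    refine mul_nonneg (Nat.cast_nonneg _) (add_nonneg (add_nonneg hc₂ (mul_nonneg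
      (mul_nonneg zero_le_two hc₁) (integral_nonneg fun _ => norm_nonneg _)))
      (integral_nonneg fun _ => norm_nonneg _))
  have hM0 : 0 ≤ M := by
    have h := (norm_nonneg _).trans (hM 1 one_pos 0)
    rwa [Real.one_rpow, mul_one] at h
  set w : E := heatExtension (fun y => φ y • f y) t x with hw
  -- the localised kernel test function
  set ψ : E → ℝ := fun y => heatKernel t (y - x) * φ y with hψ
  set Ψ : E → E := fun y => ψ y • w with hΨ
  have hu : ContDiff ℝ 2 (fun y : E => heatKernel t (y - x)) :=
    (FunctionSpaces.contDiff_heatKernel' t).comp (contDiff_id.sub contDiff_const)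
  have hψd : ContDiff ℝ 2 ψ := hu.mul hφ
  have hψc : HasCompactSupport ψ := hφc.mul_left
  have hΨd : ContDiff ℝ 2 Ψ := hψd.smul contDiff_const
  have hΨc : HasCompactSupport Ψ := hψc.smul_right
  have hψ0 : ∀ y, |ψ y| ≤ heatKernel t (y - x) := fun y => by
    rw [hψ]; dsimp only
    rw [abs_mul, abs_of_pos (heatKernel_pos ht _)]
    exact mul_le_of_le_one_right (heatKernel_pos ht _).le (h0 y)
  -- (1) `‖w‖² = ∫⟪f, Ψ⟫`
  have hint_g : Integrable (fun y => ψ y • f y) volume :=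
    integrable_smul_of_hasCompactSupport hψd.continuous hψc hf hG
  have hrepr : w = ∫ y, ψ y • f y := by
    rw [hw, Literature.Analysis.UnboundedOperators.heatExtension_eq_integral_sub]
    refine integral_congr_ae (Eventually.of_forall fun y => ?_)
    rw [hψ]; dsimp only
    rw [smul_smul, ← neg_sub y x, heatKernel_neg]
  have hsq : ‖w‖ ^ 2 = ∫ y, ⟪f y, Ψ y⟫ := by
    rw [← real_inner_self_eq_norm_sq]
    have e1 : ⟪w, w⟫ = ⟪w, ∫ y, ψ y • f y⟫ := by rw [← hrepr]
    rw [e1, ← integral_inner hint_g w]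
    refine integral_congr_ae (Eventually.of_forall fun y => ?_)
    rw [hΨ]; dsimp only
    rw [real_inner_smul_right, real_inner_smul_right, real_inner_comm]
  -- (2) the duality bound for `Ψ`
  have hmain := norm_integral_inner_le_of_heatExtension_bound hf hG hM hΨd hΨc ht
  -- (3) `∫‖Ψ‖ ≤ ‖w‖`
  have hΨ1 : ∫ y, ‖Ψ y‖ ≤ ‖w‖ := by
    have hK : Integrable (fun y : E => heatKernel t (y - x) * ‖w‖) :=
      ((integrable_heatKernel_holds ht).comp_sub_right x).mul_const _
    calc ∫ y, ‖Ψ y‖ ≤ ∫ y, heatKernel t (y - x) * ‖w‖ := by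
          refine integral_mono_of_nonneg (Eventually.of_forall fun y => norm_nonneg _) hK
            (Eventually.of_forall fun y => ?_)
          rw [hΨ]; dsimp only
          rw [norm_smul, Real.norm_eq_abs]
          exact mul_le_mul_of_nonneg_right (hψ0 y) (norm_nonneg _)
      _ = ‖w‖ := by
          rw [integral_mul_const, integral_sub_right_eq_self (heatKernel t) x,
            integral_heatKernel_eq_one_holds ht, one_mul]
  -- (4) `∫‖ΔΨ‖ ≤ ‖w‖ B / t`
  have hL : Ψ = (⇑(ContinuousLinearMap.smulRight (1 : ℝ →L[ℝ] ℝ) w)) ∘ ψ := by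
    funext y; simp [hΨ]
  have hΔΨ : ∀ y, (Δ Ψ) y = (Δ ψ) y • w := fun y => by
    rw [hL, (hψd.contDiffAt).laplacian_CLM_comp_left]
    simp
  have hΨ2 : ∫ y, ‖(Δ Ψ) y‖ ≤ ‖w‖ * (B / t) := by
    have e : (fun y => ‖(Δ Ψ) y‖) = fun y => |(Δ ψ) y| * ‖w‖ := by
      funext y; rw [hΔΨ, norm_smul, Real.norm_eq_abs]
    rw [e, integral_mul_const, mul_comm]
    refine mul_le_mul_of_nonneg_left ?_ (norm_nonneg _)
    have := integral_abs_laplacian_kernel_mul_le hφ hc₁ hc₂ hr h0 h1 h2 ht htr x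
    rw [← hB] at this
    exact this
  -- (5) algebra
  set K : ℝ := (1 + 2 * B) * M * t ^ (-(1 / 2 : ℝ)) with hK
  have hK0 : 0 ≤ K := by rw [hK]; positivity
  have ht12 : t ^ (1 / 2 : ℝ) * (B / t) = B * t ^ (-(1 / 2 : ℝ)) := by
    have : t ^ (1 / 2 : ℝ) / t = t ^ (-(1 / 2 : ℝ)) := by
      rw [div_eq_mul_inv, ← Real.rpow_neg_one, ← Real.rpow_add ht]
      norm_num
    rw [← this]; ring
  have hsq_le : ‖w‖ * ‖w‖ ≤ ‖w‖ * K := by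
    calc ‖w‖ * ‖w‖ = ‖w‖ ^ 2 := (pow_two _).symm
      _ = ∫ y, ⟪f y, Ψ y⟫ := hsq
      _ ≤ ‖∫ y, ⟪f y, Ψ y⟫‖ := Real.le_norm_self _
      _ ≤ M * (t ^ (-(1 / 2 : ℝ)) * (∫ y, ‖Ψ y‖) + 2 * t ^ (1 / 2 : ℝ) * ∫ y, ‖(Δ Ψ) y‖) := hmain
      _ ≤ M * (t ^ (-(1 / 2 : ℝ)) * ‖w‖ + 2 * t ^ (1 / 2 : ℝ) * (‖w‖ * (B / t))) := by
          gcongr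
      _ = ‖w‖ * K := by
          rw [hK]
          have : 2 * t ^ (1 / 2 : ℝ) * (‖w‖ * (B / t)) = 2 * ‖w‖ * (t ^ (1 / 2 : ℝ) * (B / t)) := by
            ring
          rw [this, ht12]
          ring
  by_cases hw0 : ‖w‖ = 0
  · rw [hw0]; exact hK0
  · exact le_of_mul_le_mul_left hsq_le (lt_of_le_of_ne (norm_nonneg _) (Ne.symm hw0))

end Cutoff

end HeatBesovPairing

end Literature.Analysis.FluidPDE
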